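import Literature.Analysis.FluidPDE.AxisymQuotientEquationsJ
import Literature.Analysis.FluidPDE.AxisymmetricVorticityTransport
import Literature.Analysis.FluidPDE.ClassicalSolutionRegion
import Literature.Analysis.FluidPDE.HarmonicVanishing
import Literature.Analysis.FluidPDE.NewtonKernel
import Literature.Analysis.FluidPDE.SelfSimilar
import HarnessLib

/-!
# GaldiLiouvilleGateAxisymGaldiLiouvilleAxialRigidity — census row S3 ⟨0896⟩ `AxisymGaldiLiouville`,
# line «cylbudget» (ns-idea-4 g8), support **O2 `AxialRigidity`**

Seat nsreg-C26-p1 g4 (DIRECTOR-NS #204 (9) / #205 (1)(ii)); statement VERBATIM = the body of `def AxialRigidity`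
of the line skeleton `pub/ideators/ns-idea-4/lines/cylbudget/AxisymGaldiLiouville_cylbudget_v1.lean` (sha16
4e06f40660ee80b9, l.72), with the files-only bundle `IsAxisymDSolution` and the functional `axialEnergyIn` unfolded to
their bodies (l.39, l.53); critic of record idea-crit-3 VERDICT 10:28:59Z, price P2 («fine as typed, M»).
`--supports stmt-NavierStokesRegularity-0896 --as helper`.

**O2.** A smooth axisymmetric D-solution `(U,P)` of the steady system `−νΔU + (U·∇)U + ∇P = 0`, `div U = 0`
(`IsLerayProfile ν 0`), tending to `0` at infinity, whose axial energy `∫_{r ≤ t} u_z²` vanishes on every solid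
cylinder, is trivial.  Proof (the critic's P2, in Cartesian form — no stream function, no swirl equation):

1. `u_z ≡ 0`: the integrand is continuous and nonnegative, so a null integral on `{r ≤ t}` kills it on the open
   cylinder `{r < t}` (`Measure.eqOn_open_of_ae_eq`), and the cylinders exhaust `ℝ³`;
2. `r u_r ≡ 0`: with `u_z ≡ 0`, `div U = 0` is `∂₀U₀ + ∂₁U₁ = 0`, and the tree's horizontal-divergence identity
   `(x₀² + x₁²)(∂₀U₀ + ∂₁U₁) = DΦ(x)[x_h]`, `Φ = x₀U₀ + x₁U₁ = r u_r` (`IsAxisymmetric.mul_divH_eq_fderiv_horizontal_inner`)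
   makes `Φ` constant along the horizontal rays from the axis, where it vanishes (mean value theorem on `s ↦ Φ(x + (s−1)x_h)`);
3. `ΔU ≡ 0`: (i) `ΔU₂ = Δ(U₂) = 0`; (ii) `x₀ΔU₀ + x₁ΔU₁ = ΔΦ − 2(∂₀U₀ + ∂₁U₁) = 0` (`laplacian_coord_mul_apply`);
   (iii) `⟪Jx, ΔU⟫ = ν⁻¹⟪Jx, (U·∇)U + ∇P⟫ = 0`, because the pressure is axisymmetric (the steady pair is a classical
   solution on `ℝ × ℝ³`, `IsClassicalNSSolutionOn.isAxisymmetricScalar_pressure`) so `DP(x)[Jx] = 0`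
   (`IsAxisymmetricScalar.fderiv_rotGen`), and `U = c • Jx` off the axis gives
   `(U·∇)U = c DU[Jx] = c J(U) = c² J²x ⊥ Jx` (`IsAxisymmetric.fderiv_rotGen`); (i)–(iii) force `ΔU(x) = 0` off the
   axis, and on the axis by continuity of `ΔU`;
4. the Cartesian components of `U` are harmonic on `ℝ³` and tend to `0` at infinity, hence vanish
   (`harmonic_eq_zero_of_tendsto_cocompact'`).

WHAT THIS IS NOT: a kinematic/elliptic support of the RUNG `FiniteSwirlEnergyLiouville` and of `AxisymGaldiLiouville_of`
of line cylbudget; neither ⟨0896⟩ `AxisymGaldiLiouville`, nor census row S3, nor Navier–Stokes regularity is proved.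
[folklore; GilbargTrudinger2001 Thm 2.1 + Liouville after Thm 2.10; KochNadirashviliSereginSverak2009 §1 (1.5)]
-/

noncomputable section

open MeasureTheory Set Filter Topology Function
open scoped ENNReal InnerProductSpace RealInnerProductSpace Laplacian ContDiff
open Literature.Analysis.FluidPDE

set_option linter.dupNamespace false

namespace Summit.NavierStokesRegularity.NavierStokesRegularity.Theorems.AxisymGaldiLiouville.CylinderBudget

/-- The coordinate of a Fréchet derivative of an `ℝ³`-valued map is the derivative of the coordinate. [folklore] -/
theorem fderiv_apply_coord {U : EuclideanSpace ℝ (Fin 3) → EuclideanSpace ℝ (Fin 3)}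
    {x : EuclideanSpace ℝ (Fin 3)} (hd : DifferentiableAt ℝ U x) (v : EuclideanSpace ℝ (Fin 3)) (i : Fin 3) :
    fderiv ℝ U x v i = fderiv ℝ (fun y => U y i) x v := by
  have h : (fun y => U y i) = (EuclideanSpace.proj i : EuclideanSpace ℝ (Fin 3) →L[ℝ] ℝ) ∘ U := rfl
  rw [h, fderiv_comp x (EuclideanSpace.proj i : EuclideanSpace ℝ (Fin 3) →L[ℝ] ℝ).differentiableAt hd,
    ContinuousLinearMap.fderiv]
  rfl

/-- **O2 `AxialRigidity`** (line cylbudget, VERBATIM body of the skeleton's `def`, with `IsAxisymDSolution` and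
`axialEnergyIn` unfolded): a smooth axisymmetric D-solution of the steady Navier–Stokes system tending to `0` at
infinity whose axial energy vanishes on every solid cylinder is identically zero (module docstring, steps 1–4).
[folklore; GilbargTrudinger2001 Thm 2.1] -/
theorem axialRigidity :
    ∀ ν : ℝ, 0 < ν → ∀ (U : EuclideanSpace ℝ (Fin 3) → EuclideanSpace ℝ (Fin 3)) (P : EuclideanSpace ℝ (Fin 3) → ℝ),
      (IsLerayProfile ν 0 U P ∧ IsAxisymmetric U ∧ ContDiff ℝ (⊤ : ℕ∞) U ∧ ContDiff ℝ (⊤ : ℕ∞) P ∧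
        (∫⁻ y, ENNReal.ofReal (frobeniusNormSq (fderiv ℝ U y))) < ⊤ ∧
        Tendsto U (cocompact (EuclideanSpace ℝ (Fin 3))) (𝓝 0)) →
      (∀ t : ℝ, 0 < t →
        (∫⁻ x in {x : EuclideanSpace ℝ (Fin 3) | cylRadius x ≤ t}, ENNReal.ofReal (axialVelocity U x ^ 2)) = 0) →
      U = 0 := by
  intro ν hν U P hsol h0
  obtain ⟨hprof, hax, hU, hP, -, hlim⟩ := hsol
  have hUc : Continuous U := hU.continuous
  have hU2 : ContDiff ℝ 2 U := contDiff_infty.1 hU 2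
  have hUd : Differentiable ℝ U := hU.differentiable (by simp)
  have hPd : Differentiable ℝ P := hP.differentiable (by simp)
  -- ### Step 1: `u_z ≡ 0`
  have hUz : ∀ x, U x 2 = 0 := by
    intro x
    set t : ℝ := cylRadius x + 1 with ht
    have ht0 : 0 < t := by have := cylRadius_nonneg x; linarith
    set f : EuclideanSpace ℝ (Fin 3) → ℝ≥0∞ := fun y => ENNReal.ofReal (axialVelocity U y ^ 2) with hf
    have hfc : Continuous f := by
      refine ENNReal.continuous_ofReal.comp ?_
      exact ((EuclideanSpace.proj (2 : Fin 3)).continuous.comp hUc).pow 2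
    have hO : IsOpen {y : EuclideanSpace ℝ (Fin 3) | cylRadius y < t} :=
      isOpen_lt continuous_cylRadius continuous_const
    have hOS : {y : EuclideanSpace ℝ (Fin 3) | cylRadius y < t} ⊆ {y | cylRadius y ≤ t} :=
      fun y (hy : cylRadius y < t) => show cylRadius y ≤ t from hy.le
    have hae : f =ᵐ[volume.restrict {y : EuclideanSpace ℝ (Fin 3) | cylRadius y ≤ t}] 0 :=
      (lintegral_eq_zero_iff hfc.measurable).1 (h0 t ht0)
    have hae' : f =ᵐ[volume.restrict {y : EuclideanSpace ℝ (Fin 3) | cylRadius y < t}] (fun _ => 0) :=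
      ae_restrict_of_ae_restrict_of_subset hOS hae
    have hEq := Measure.eqOn_open_of_ae_eq hae' hO hfc.continuousOn continuousOn_const
    have hx : x ∈ {y : EuclideanSpace ℝ (Fin 3) | cylRadius y < t} := by
      show cylRadius x < t; rw [ht]; linarith
    have h1 : f x = 0 := hEq hx
    rw [hf] at h1
    simp only [ENNReal.ofReal_eq_zero] at h1
    have h2 : axialVelocity U x ^ 2 = 0 := le_antisymm h1 (sq_nonneg _)
    exact pow_eq_zero_iff (two_ne_zero) |>.1 h2
  -- the axial coordinate function vanishes identically, so do its derivatives
  have hUz_fun : (fun y : EuclideanSpace ℝ (Fin 3) => U y 2) = fun _ => 0 := funext hUz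
  have hdUz : ∀ x v, fderiv ℝ U x v 2 = 0 := by
    intro x v
    rw [fderiv_apply_coord (hUd x), hUz_fun]
    simp
  -- ### Step 2: the horizontal divergence and `Φ = x₀U₀ + x₁U₁ ≡ 0`
  have hdivH : ∀ x : EuclideanSpace ℝ (Fin 3),
      fderiv ℝ U x (EuclideanSpace.single 0 1) 0 + fderiv ℝ U x (EuclideanSpace.single 1 1) 1 = 0 := by
    intro x
    have hdiv := hprof.divFree x
    rw [divergence_eq_sum_inner_fderiv (EuclideanSpace.basisFun (Fin 3) ℝ)] at hdiv
    simp only [Fin.sum_univ_three, EuclideanSpace.basisFun_apply, EuclideanSpace.inner_single_left, map_one,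
      one_mul] at hdiv
    rw [hdUz] at hdiv
    linarith
  set Φ : EuclideanSpace ℝ (Fin 3) → ℝ := fun y => y 0 * U y 0 + y 1 * U y 1 with hΦ_def
  have hΦd : Differentiable ℝ Φ := by
    have h0 : Differentiable ℝ fun y : EuclideanSpace ℝ (Fin 3) => U y 0 :=
      (EuclideanSpace.proj (0 : Fin 3) : EuclideanSpace ℝ (Fin 3) →L[ℝ] ℝ).differentiable.comp hUd
    have h1 : Differentiable ℝ fun y : EuclideanSpace ℝ (Fin 3) => U y 1 :=
      (EuclideanSpace.proj (1 : Fin 3) : EuclideanSpace ℝ (Fin 3) →L[ℝ] ℝ).differentiable.comp hUd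
    exact (((EuclideanSpace.proj (0 : Fin 3)).differentiable).mul h0).add
      (((EuclideanSpace.proj (1 : Fin 3)).differentiable).mul h1)
  have hray : ∀ y : EuclideanSpace ℝ (Fin 3),
      fderiv ℝ Φ y ((y 0) • EuclideanSpace.single 0 1 + (y 1) • EuclideanSpace.single 1 1) = 0 := by
    intro y
    have h := hax.mul_divH_eq_fderiv_horizontal_inner (hUd y)
    rw [hdivH y, mul_zero] at h
    exact h.symm
  have hΦ0 : ∀ x, Φ x = 0 := by
    intro x
    set xh : EuclideanSpace ℝ (Fin 3) := (x 0) • EuclideanSpace.single 0 1 + (x 1) • EuclideanSpace.single 1 1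
      with hxh
    set γ : ℝ → EuclideanSpace ℝ (Fin 3) := fun s => x + (s - 1) • xh with hγ
    have hγd : ∀ s, HasDerivAt γ xh s := by
      intro s
      have h1 : HasDerivAt (fun s : ℝ => s - 1) 1 s := (hasDerivAt_id s).sub_const 1
      have h2 := h1.smul_const xh
      rw [one_smul] at h2
      exact (h2.const_add x)
    set g : ℝ → ℝ := fun s => Φ (γ s) with hg
    have hgd : ∀ s, HasDerivAt g (fderiv ℝ Φ (γ s) xh) s := fun s =>
      (hΦd (γ s)).hasFDerivAt.comp_hasDerivAt s (hγd s)
    -- the horizontal part of `γ s` is `s • xh`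
    have hγh : ∀ s, (γ s 0) • EuclideanSpace.single 0 1 + (γ s 1) • EuclideanSpace.single 1 1 = s • xh := by
      intro s
      have e0 : γ s 0 = s * x 0 := by
        simp only [hγ, hxh]
        simp
        ring
      have e1 : γ s 1 = s * x 1 := by
        simp only [hγ, hxh]
        simp
        ring
      rw [e0, e1, hxh, smul_add, smul_smul, smul_smul]
    have hderiv0 : ∀ s, s ≠ 0 → fderiv ℝ Φ (γ s) xh = 0 := by
      intro s hs
      have h := hray (γ s)
      rw [hγh s, map_smul, smul_eq_mul] at h
      rcases mul_eq_zero.1 h with h' | h'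
      · exact absurd h' hs
      · exact h'
    -- mean value theorem on `[0,1]`
    have hgc : ContinuousOn g (Icc 0 1) := fun s _ => (hgd s).continuousAt.continuousWithinAt
    have hgdiff : DifferentiableOn ℝ g (Ioo 0 1) := fun s _ => (hgd s).differentiableAt.differentiableWithinAt
    obtain ⟨c, hc, hcd⟩ := exists_deriv_eq_slope g zero_lt_one hgc hgdiff
    have hc0 : deriv g c = 0 := by rw [(hgd c).deriv]; exact hderiv0 c hc.1.ne'
    rw [hc0, sub_zero, div_one] at hcd
    have hg0 : g 0 = 0 := by
      simp only [hg, hΦ_def, hγ, hxh]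
      simp
    have hg1 : g 1 = Φ x := by simp [hg, hγ]
    linarith
  -- ### Step 3a: off the axis `U = c • Jx`
  have hUJ : ∀ x : EuclideanSpace ℝ (Fin 3), x 0 ^ 2 + x 1 ^ 2 ≠ 0 →
      U x = ((x 0 * U x 1 - x 1 * U x 0) / (x 0 ^ 2 + x 1 ^ 2)) • rotGen x := by
    intro x hx
    have hΦx : x 0 * U x 0 + x 1 * U x 1 = 0 := hΦ0 x
    ext i
    fin_cases i
    · simp only [Fin.zero_eta, Fin.isValue, PiLp.smul_apply, rotGen_apply_zero, smul_eq_mul]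
      field_simp
      linear_combination (x 0) * hΦx
    · simp only [Fin.mk_one, Fin.isValue, PiLp.smul_apply, rotGen_apply_one, smul_eq_mul]
      field_simp
      linear_combination (x 1) * hΦx
    · simp only [Fin.reduceFinMk, PiLp.smul_apply, rotGen_apply_two, smul_eq_mul, mul_zero]
      exact hUz x
  -- ### Step 3b: the pressure is axisymmetric
  have hmom : ∀ x ∈ (univ : Set (EuclideanSpace ℝ (Fin 3))),
      convect U U x = ν • (Δ U) x - gradient P x + (0 : EuclideanSpace ℝ (Fin 3) → EuclideanSpace ℝ (Fin 3)) x := by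
    intro x _
    have h := hprof.profile_eq x
    simp only [zero_smul, add_zero, Pi.zero_apply] at h ⊢
    -- `h : -(ν • Δ U x) + convect U U x + gradient P x = 0`
    rw [eq_sub_iff_add_eq]
    have : convect U U x + gradient P x = ν • (Δ U) x := by
      rw [← sub_eq_zero]
      rw [← h]
      abel
    exact this
  have hst : IsClassicalNSSolutionOn (univ : Set ℝ) ν (fun _ => (0 : EuclideanSpace ℝ (Fin 3) → EuclideanSpace ℝ (Fin 3)))
      (fun _ => U) (fun _ => P) :=
    (IsClassicalNSSolutionOnRegion.of_steady hU.contDiffOn hP.contDiffOn hmom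
      (fun x _ => hprof.divFree x) (univ : Set ℝ)).isClassicalNSSolutionOn
  have hPax : IsAxisymmetricScalar P :=
    hst.isAxisymmetricScalar_pressure uniqueDiffOn_univ (fun _ _ => hax)
      (fun _ _ θ y => by ext i; fin_cases i <;> simp) (mem_univ (0 : ℝ))
  -- ### Step 3c: `ΔU = 0` off the axis
  have hΔU2 : ∀ x, (Δ U) x 2 = 0 := by
    intro x
    rw [laplacian_apply_coord_vec3 hU2 x 2, hUz_fun]
    simp
  have hΔUh : ∀ x : EuclideanSpace ℝ (Fin 3), x 0 * (Δ U) x 0 + x 1 * (Δ U) x 1 = 0 := by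
    intro x
    have hΦ_fun : Φ = fun _ => 0 := funext hΦ0
    have hprod : ∀ i : Fin 3, ContDiff ℝ 2 (fun y : EuclideanSpace ℝ (Fin 3) => y i * U y i) := fun i =>
      (EuclideanSpace.proj (𝕜 := ℝ) i).contDiff.mul (contDiff_apply_coord_vec3 hU2 i)
    have hsum : Φ = (fun y : EuclideanSpace ℝ (Fin 3) => y 0 * U y 0) + fun y : EuclideanSpace ℝ (Fin 3) => y 1 * U y 1 :=
      rfl
    have hΔΦ : (Δ Φ) x = 0 := by rw [hΦ_fun]; simp
    rw [hsum, ContDiffAt.laplacian_add (hprod 0).contDiffAt (hprod 1).contDiffAt,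
      laplacian_coord_mul_apply hU2 0 x, laplacian_coord_mul_apply hU2 1 x] at hΔΦ
    have hd := hdivH x
    linarith
  have hΔUJ : ∀ x : EuclideanSpace ℝ (Fin 3), x 0 ^ 2 + x 1 ^ 2 ≠ 0 →
      x 0 * (Δ U) x 1 - x 1 * (Δ U) x 0 = 0 := by
    intro x hx
    -- `⟪Jx, ∇P⟫ = 0`
    have hgradP : ⟪rotGen x, gradient P x⟫ = 0 := by
      rw [real_inner_comm, gradient, InnerProductSpace.toDual_symm_apply]
      exact hPax.fderiv_rotGen (hPd x)
    -- `⟪Jx, (U·∇)U⟫ = 0`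
    set c : ℝ := (x 0 * U x 1 - x 1 * U x 0) / (x 0 ^ 2 + x 1 ^ 2) with hc
    have hconv : ⟪rotGen x, convect U U x⟫ = 0 := by
      rw [convect, hUJ x hx, map_smul, hax.fderiv_rotGen (hUd x), hUJ x hx, inner_smul_right]
      have : ⟪rotGen x, rotGen (c • rotGen x)⟫ = 0 := by
        rw [inner_rotGen_left]
        simp [rotGen_apply_zero, rotGen_apply_one]
        ring
      rw [this, mul_zero]
    -- the `J`-component of the momentum equation
    have hm := hmom x (mem_univ x)
    simp only [Pi.zero_apply, add_zero] at hm
    have h1 : ⟪rotGen x, ν • (Δ U) x⟫ = 0 := by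
      have : ν • (Δ U) x = convect U U x + gradient P x := by rw [hm]; abel
      rw [this, inner_add_right, hconv, hgradP, add_zero]
    rw [inner_smul_right, inner_rotGen_left] at h1
    rcases mul_eq_zero.1 h1 with h' | h'
    · exact absurd h' hν.ne'
    · linarith
  have hΔU_off : ∀ x : EuclideanSpace ℝ (Fin 3), x 0 ^ 2 + x 1 ^ 2 ≠ 0 → (Δ U) x = 0 := by
    intro x hx
    have h1 := hΔUh x
    have h2 := hΔUJ x hx
    have h3 := hΔU2 x
    have hv0 : (Δ U) x 0 = 0 := by
      have : (x 0 ^ 2 + x 1 ^ 2) * (Δ U) x 0 = 0 := by linear_combination (x 0) * h1 - (x 1) * h2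
      rcases mul_eq_zero.1 this with h' | h'
      · exact absurd h' hx
      · exact h'
    have hv1 : (Δ U) x 1 = 0 := by
      have : (x 0 ^ 2 + x 1 ^ 2) * (Δ U) x 1 = 0 := by linear_combination (x 1) * h1 + (x 0) * h2
      rcases mul_eq_zero.1 this with h' | h'
      · exact absurd h' hx
      · exact h'
    ext i
    fin_cases i
    · exact hv0
    · exact hv1
    · exact h3
  -- ### Step 3d: `ΔU = 0` everywhere (continuity across the axis)
  have hΔc : Continuous (Δ U) :=
    (contDiff_laplacian (n := 0) (by simpa using contDiff_infty.1 hU 2)).continuous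
  have hΔU : ∀ x, (Δ U) x = 0 := by
    intro x
    by_cases hx : x 0 ^ 2 + x 1 ^ 2 ≠ 0
    · exact hΔU_off x hx
    · push Not at hx
      have hx0 : x 0 = 0 := by nlinarith [sq_nonneg (x 0), sq_nonneg (x 1)]
      -- approach `x` along `x + ε e₀`, `ε → 0`, `ε ≠ 0`
      have hlimc : Tendsto (fun ε : ℝ => (Δ U) (x + ε • EuclideanSpace.single 0 1)) (𝓝[≠] 0) (𝓝 ((Δ U) x)) := by
        have hcont : Continuous fun ε : ℝ => (Δ U) (x + ε • EuclideanSpace.single 0 1) :=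
          hΔc.comp (continuous_const.add (continuous_id.smul continuous_const))
        have := hcont.tendsto 0
        simp only [zero_smul, add_zero] at this
        exact this.mono_left nhdsWithin_le_nhds
      have hev : ∀ᶠ ε : ℝ in 𝓝[≠] 0, (Δ U) (x + ε • EuclideanSpace.single 0 1) = 0 := by
        filter_upwards [self_mem_nhdsWithin] with ε hε
        refine hΔU_off _ ?_
        have e0 : (x + ε • EuclideanSpace.single 0 1 : EuclideanSpace ℝ (Fin 3)) 0 = ε := by
          simp [hx0]
        rw [e0]
        intro h
        have : ε ^ 2 = 0 := by
          nlinarith [sq_nonneg ε, sq_nonneg ((x + ε • EuclideanSpace.single 0 1 : EuclideanSpace ℝ (Fin 3)) 1)]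
        exact hε (pow_eq_zero_iff two_ne_zero |>.1 this)
      have hlim0 : Tendsto (fun ε : ℝ => (Δ U) (x + ε • EuclideanSpace.single 0 1)) (𝓝[≠] 0) (𝓝 0) :=
        (tendsto_congr' hev).2 tendsto_const_nhds
      exact tendsto_nhds_unique hlimc hlim0
  -- ### Step 4: harmonic and vanishing at infinity
  have hharm : InnerProductSpace.HarmonicOnNhd U univ := by
    intro x _
    refine ⟨hU2.contDiffAt, ?_⟩
    exact Eventually.of_forall fun y => hΔU y
  exact harmonic_eq_zero_of_tendsto_cocompact' hharm hlim

end Summit.NavierStokesRegularity.NavierStokesRegularity.Theorems.AxisymGaldiLiouville.CylinderBudget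

end
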